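import Literature.Analysis.FunctionSpaces.BesselJProofs
import Mathlib.Analysis.Analytic.OfScalars
import Mathlib.Analysis.Analytic.Constructions
import Mathlib.Analysis.Calculus.ContDiff.Defs
import Mathlib.Analysis.SpecialFunctions.Exponential
import Mathlib.Analysis.SpecialFunctions.Integrals.Basic
import Mathlib.MeasureTheory.Integral.DominatedConvergence
import Mathlib.Analysis.Normed.Ring.InfiniteSum
import Mathlib.Topology.Algebra.Order.Floor
import HarnessLib

/-!
# Bessel functions of integer order: analyticity, Bessel's integral and the bound `|J_n| ≤ 1`

Second proofs sibling of `Literature/Analysis/FunctionSpaces/BesselJ.lean` (kept apart from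
`BesselJProofs.lean`, which the whole random-walk / Lieb–Wu cone imports). Discharges

* `contDiff_besselJ_holds` — **`J_n` is smooth, indeed real-analytic, on `ℝ`** (Watson §2.11: "an
  everywhere convergent power series"): `J_n(x) = (x/2)ⁿ · G_n((x/2)²)` with the entire series
  `G_n(u) = Σ_k (−1)^k u^k/(k!(k+n)!)` (Mathlib's `FormalMultilinearSeries.ofScalars`, radius `⊤`
  by the ratio test), hence analytic (`analyticAt_besselJ`) and `C^m` for every `m ≤ ω`;
* `besselJ_eq_integral_cos_holds` — **Bessel's integral** `J_n(x) = π⁻¹ ∫₀^π cos(nθ − x sin θ) dθ`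
  (Watson §2.2 (1); DLMF 10.9.2), by the generating-function argument: for fixed `x, θ`,
  `e^{ix sin θ} = exp((x/2)e^{iθ}) exp(−(x/2)e^{−iθ}) = Σ_{j,k} (x/2)^j(−x/2)^k e^{i(j−k)θ}/(j!k!)`
  (absolutely convergent double series), and integrating against `e^{−inθ}` over `[0, 2π]` term by
  term (dominated convergence) kills all terms but `j = k + n`, leaving
  `2π Σ_k (−1)^k (x/2)^{2k+n}/(k!(k+n)!) = 2π J_n(x)` (`integral_cexp_mul_sin_sub`); the real part
  and the symmetry `θ ↦ 2π − θ` give the printed form (Watson §2.2);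
* `abs_besselJ_le_one_holds` — **`|J_n(x)| ≤ 1`** (DLMF 10.14.1), immediate from Bessel's
  integral;
* `abs_besselJ_succ_le_holds` — **`|J_n(x)| ≤ 1/√2` for `n ≥ 1`** (DLMF 10.14.1), from
  **Neumann's identity** `J₀² + 2Σ_{n≥1} J_n² = 1` (`sq_besselJ_zero_add_tsum_sq`, Watson §2.5 (3)),
  proved by term-wise differentiation (`|J_n(x)| ≤ (|x/2|ⁿ/n!)e^{|x/2|²}`,
  `J_{n+1}' = (J_n − J_{n+2})/2` everywhere) and the telescoping of `Σ J_{n+1}(J_n − J_{n+2})`.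

## References

* G. N. Watson, *A Treatise on the Theory of Bessel Functions* (2nd ed., CUP 1944), §2.11
  (analyticity), §2.2 (1) (Bessel's integral), §2.1 (the generating function), §2.5 (3)
  (Neumann's identity), §2.12 (2) (`2J_ν' = J_{ν−1} − J_{ν+1}`). [`Watson1944`]
* NIST DLMF 10.9.2, 10.14.1. [`DLMF`]
-/

noncomputable section

open scoped Topology Nat
open Filter Asymptotics Real MeasureTheory Set intervalIntegral FormalMultilinearSeries

namespace Literature.Analysis.FunctionSpaces

/-! ### Analyticity -/

/-- The coefficients `c_k = (−1)^k/(k!(k+n)!)` of the entire series `G_n(u) = Σ c_k u^k` with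
`J_n(x) = (x/2)ⁿ G_n((x/2)²)`. [folklore] -/
def besselCoeff (n : ℕ) (k : ℕ) : ℝ := (-1 : ℝ) ^ k / ((k ! : ℝ) * ((k + n) ! : ℝ))

/-- `c_k ≠ 0`. [folklore] -/
theorem besselCoeff_ne_zero (n k : ℕ) : besselCoeff n k ≠ 0 := by
  unfold besselCoeff
  exact div_ne_zero (pow_ne_zero _ (by norm_num)) (by positivity)

/-- `|c_k| = 1/(k!(k+n)!)`. [folklore] -/
theorem norm_besselCoeff (n k : ℕ) : ‖besselCoeff n k‖ = 1 / ((k ! : ℝ) * ((k + n) ! : ℝ)) := by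
  rw [besselCoeff, norm_div, norm_pow, norm_neg, norm_one, one_pow, Real.norm_of_nonneg (by positivity)]

/-- The ratio `|c_{k+1}|/|c_k| = 1/((k+1)(k+n+1))`. [folklore] -/
theorem norm_besselCoeff_succ_div (n k : ℕ) :
    ‖besselCoeff n (k + 1)‖ / ‖besselCoeff n k‖ = 1 / (((k : ℝ) + 1) * ((k : ℝ) + n + 1)) := by
  rw [norm_besselCoeff, norm_besselCoeff]
  have h1 : ((k + 1) ! : ℝ) = ((k : ℝ) + 1) * (k ! : ℝ) := by
    rw [Nat.factorial_succ]; push_cast; ring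
  have h2 : ((k + 1 + n) ! : ℝ) = ((k : ℝ) + n + 1) * ((k + n) ! : ℝ) := by
    rw [show k + 1 + n = (k + n) + 1 by omega, Nat.factorial_succ]; push_cast; ring
  rw [h1, h2]
  have hk : (k ! : ℝ) ≠ 0 := by positivity
  have hkn : ((k + n) ! : ℝ) ≠ 0 := by positivity
  field_simp

/-- **The series `G_n` is entire**: radius of convergence `⊤` (ratio test). [cite: Watson1944, §2.11] -/
theorem radius_ofScalars_besselCoeff (n : ℕ) : (ofScalars ℝ (besselCoeff n)).radius = ⊤ := by
  refine ofScalars_radius_eq_top_of_tendsto ℝ (besselCoeff n)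
    (Eventually.of_forall (besselCoeff_ne_zero n)) ?_
  have h : Tendsto (fun k : ℕ => 1 / (((k : ℝ) + 1) * ((k : ℝ) + n + 1))) atTop (𝓝 0) := by
    have h1 : Tendsto (fun k : ℕ => 1 / ((k : ℝ) + 1)) atTop (𝓝 0) :=
      tendsto_one_div_add_atTop_nhds_zero_nat
    refine squeeze_zero (fun k => by positivity) (fun k => ?_) h1
    apply one_div_le_one_div_of_le (by positivity)
    have : (0 : ℝ) ≤ (k : ℝ) + n := by positivity
    nlinarith
  refine h.congr fun k => ?_
  rw [norm_besselCoeff_succ_div]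

/-- **`J_n(x) = (x/2)ⁿ · G_n((x/2)²)`** with `G_n` the sum of the entire series. [cite: Watson1944, §2.11] -/
theorem besselJ_eq_mul_ofScalarsSum (n : ℕ) (x : ℝ) :
    besselJ n x = (x / 2) ^ n * ofScalarsSum (E := ℝ) (besselCoeff n) ((x / 2) ^ 2) := by
  rw [besselJ, ofScalars_sum_eq, ← tsum_mul_left]
  refine tsum_congr fun k => ?_
  rw [smul_eq_mul, besselJTerm, besselCoeff, pow_add, pow_mul]
  ring

/-- **`J_n` is real-analytic at every point.** [cite: Watson1944, §2.11] -/
theorem analyticAt_besselJ (n : ℕ) (x : ℝ) : AnalyticAt ℝ (besselJ n) x := by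
  have hfun : besselJ n = fun y : ℝ => (y / 2) ^ n * ofScalarsSum (E := ℝ) (besselCoeff n) ((y / 2) ^ 2) :=
    funext (besselJ_eq_mul_ofScalarsSum n)
  rw [hfun]
  have h1 : AnalyticAt ℝ (fun y : ℝ => (y / 2) ^ n) x :=
    ((analyticAt_id).div analyticAt_const (by norm_num)).pow n
  have h3 : AnalyticAt ℝ (fun y : ℝ => (y / 2) ^ 2) x :=
    ((analyticAt_id).div analyticAt_const (by norm_num)).pow 2
  have h2 : AnalyticAt ℝ (ofScalarsSum (E := ℝ) (besselCoeff n)) ((x / 2) ^ 2) := by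
    have hball := (ofScalars ℝ (besselCoeff n)).hasFPowerSeriesOnBall
      (by rw [radius_ofScalars_besselCoeff]; exact ENNReal.zero_lt_top)
    exact hball.analyticAt_of_mem (by rw [radius_ofScalars_besselCoeff]; simp)
  have h23 : AnalyticAt ℝ ((ofScalarsSum (E := ℝ) (besselCoeff n)) ∘ fun y : ℝ => (y / 2) ^ 2) x :=
    h2.comp_of_eq h3 rfl
  exact h1.mul h23

/-- **Discharge of `Literature.Analysis.FunctionSpaces.contDiff_besselJ`**: `J_n` is `C^m` on `ℝ`
for every `m` (including `m = ω`: it is real-analytic). [cite: Watson1944, §2.11] -/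
theorem contDiff_besselJ_holds : contDiff_besselJ := by
  intro n m
  have h : AnalyticOnNhd ℝ (besselJ n) univ := fun x _ => analyticAt_besselJ n x
  exact h.contDiff

/-! ### Bessel's integral -/

/-- `∫₀^{2π} e^{imθ} dθ = 2π [m = 0]` for `m ∈ ℤ`. [folklore] -/
theorem integral_cexp_int_mul (m : ℤ) :
    ∫ θ in (0 : ℝ)..2 * π, Complex.exp ((m : ℂ) * θ * Complex.I) =
      if m = 0 then 2 * (π : ℂ) else 0 := by
  rcases eq_or_ne m 0 with hm | hm
  · rw [if_pos hm, hm]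
    have hfun : (fun θ : ℝ => Complex.exp ((((0 : ℤ) : ℂ)) * θ * Complex.I)) = fun _ => 1 := by
      funext θ
      rw [Int.cast_zero, zero_mul, zero_mul, Complex.exp_zero]
    rw [hfun, intervalIntegral.integral_const, sub_zero, Complex.real_smul, mul_one]
    push_cast
    ring
  · rw [if_neg hm]
    have hc : (m : ℂ) * Complex.I ≠ 0 :=
      mul_ne_zero (Int.cast_ne_zero.mpr hm) Complex.I_ne_zero
    have h := integral_exp_mul_complex (a := 0) (b := 2 * π) hc
    have hfun : (fun θ : ℝ => Complex.exp ((m : ℂ) * θ * Complex.I)) =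
        fun θ : ℝ => Complex.exp ((m : ℂ) * Complex.I * θ) := by
      funext θ; ring_nf
    rw [hfun, h]
    have h2 : Complex.exp ((m : ℂ) * Complex.I * ((2 * π : ℝ) : ℂ)) = 1 := by
      have := Complex.exp_int_mul_two_pi_mul_I m
      rw [← this]; congr 1; push_cast; ring
    rw [h2]
    simp

/-- The exponential series in `HasSum` form for `Complex.exp`. [folklore] -/
theorem hasSum_pow_div_factorial_cexp (z : ℂ) :
    HasSum (fun j : ℕ => z ^ j / (j ! : ℂ)) (Complex.exp z) := by
  rw [Complex.exp_eq_exp_ℂ]; exact NormedSpace.expSeries_div_hasSum_exp z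

/-- The product of two exponential series as an absolutely convergent double series. [folklore] -/
theorem hasSum_prod_pow_div_factorial (z₁ z₂ : ℂ) :
    HasSum (fun p : ℕ × ℕ => z₁ ^ p.1 / (p.1 ! : ℂ) * (z₂ ^ p.2 / (p.2 ! : ℂ)))
      (Complex.exp z₁ * Complex.exp z₂) := by
  have hb : Summable fun p : ℕ × ℕ => ‖z₁‖ ^ p.1 / (p.1 ! : ℝ) * (‖z₂‖ ^ p.2 / (p.2 ! : ℝ)) :=
    (Real.summable_pow_div_factorial ‖z₁‖).mul_of_nonneg (Real.summable_pow_div_factorial ‖z₂‖)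
      (fun _ => by positivity) (fun _ => by positivity)
  have hs : Summable fun p : ℕ × ℕ => z₁ ^ p.1 / (p.1 ! : ℂ) * (z₂ ^ p.2 / (p.2 ! : ℂ)) := by
    refine Summable.of_norm_bounded hb (fun p => le_of_eq ?_)
    rw [norm_mul, norm_div, norm_div, norm_pow, norm_pow, Complex.norm_natCast, Complex.norm_natCast]
  have h := hs.hasSum
  have hval : ∑' p : ℕ × ℕ, z₁ ^ p.1 / (p.1 ! : ℂ) * (z₂ ^ p.2 / (p.2 ! : ℂ)) =
      Complex.exp z₁ * Complex.exp z₂ := by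
    rw [hs.tsum_prod, ← (hasSum_pow_div_factorial_cexp z₁).tsum_eq,
      ← (hasSum_pow_div_factorial_cexp z₂).tsum_eq, ← tsum_mul_right]
    refine tsum_congr fun j => ?_
    rw [← tsum_mul_left]
  rw [hval] at h
  exact h

/-- `exp((x/2)e^{iθ}) · exp(−(x/2)e^{−iθ}) = e^{ix sin θ}`. [cite: Watson1944, §2.1] -/
theorem cexp_mul_cexp_eq_cexp_mul_sin (x θ : ℝ) :
    Complex.exp ((x / 2 : ℂ) * Complex.exp (θ * Complex.I)) *
        Complex.exp (((-(x / 2) : ℝ) : ℂ) * Complex.exp (-(θ * Complex.I))) =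
      Complex.exp ((x : ℂ) * Real.sin θ * Complex.I) := by
  rw [← Complex.exp_add]
  congr 1
  have e1 : Complex.exp ((θ : ℂ) * Complex.I) = Complex.cos θ + Complex.sin θ * Complex.I :=
    Complex.exp_mul_I _
  have e2 : Complex.exp (-((θ : ℂ) * Complex.I)) = Complex.cos θ - Complex.sin θ * Complex.I := by
    rw [show -((θ : ℂ) * Complex.I) = (-(θ : ℂ)) * Complex.I by ring, Complex.exp_mul_I,
      Complex.cos_neg, Complex.sin_neg]
    ring
  rw [Complex.ofReal_sin, e1, e2]
  push_cast
  ring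

/-- The generating-function double series: for real `x, θ`,
`Σ_{j,k} ((x/2)e^{iθ})^j/j! · ((−x/2)e^{−iθ})^k/k! = e^{i x sin θ}` (absolutely convergent).
[cite: Watson1944, §2.1] -/
theorem hasSum_generatingFunction (x θ : ℝ) :
    HasSum (fun p : ℕ × ℕ =>
      ((x / 2 : ℂ) * Complex.exp (θ * Complex.I)) ^ p.1 / (p.1 ! : ℂ) *
        ((((-(x / 2) : ℝ) : ℂ) * Complex.exp (-(θ * Complex.I))) ^ p.2 / (p.2 ! : ℂ)))
      (Complex.exp ((x : ℂ) * Real.sin θ * Complex.I)) := by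
  have h := hasSum_prod_pow_div_factorial ((x / 2 : ℂ) * Complex.exp (θ * Complex.I))
    (((-(x / 2) : ℝ) : ℂ) * Complex.exp (-(θ * Complex.I)))
  rw [cexp_mul_cexp_eq_cexp_mul_sin] at h
  exact h

/-- **`∫₀^{2π} e^{i(x sin θ − nθ)} dθ = 2π J_n(x)`** (`n ∈ ℕ`): the Fourier coefficients of the
generating function `e^{ix sin θ}` are the Bessel functions. [cite: Watson1944, §2.2 (1)] -/
theorem integral_cexp_mul_sin_sub (n : ℕ) (x : ℝ) :
    ∫ θ in (0 : ℝ)..2 * π,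
        Complex.exp ((x : ℂ) * Real.sin θ * Complex.I) * Complex.exp (-((n : ℂ) * θ * Complex.I)) =
      2 * π * (besselJ n x : ℂ) := by
  -- the summands, integrated term by term
  set F : ℕ × ℕ → ℝ → ℂ := fun p θ =>
    ((x / 2 : ℂ) * Complex.exp (θ * Complex.I)) ^ p.1 / (p.1 ! : ℂ) *
      ((((-(x / 2) : ℝ) : ℂ) * Complex.exp (-(θ * Complex.I))) ^ p.2 / (p.2 ! : ℂ)) *
        Complex.exp (-((n : ℂ) * θ * Complex.I)) with hF
  have hFcont : ∀ p, Continuous (F p) := fun p => by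
    simp only [hF]; fun_prop
  have hFnorm : ∀ p θ, ‖F p θ‖ = (|x| / 2) ^ p.1 / (p.1 ! : ℝ) * ((|x| / 2) ^ p.2 / (p.2 ! : ℝ)) := by
    intro p θ
    simp only [hF, norm_mul, norm_div, norm_pow, Complex.norm_natCast, Complex.norm_real,
      Complex.norm_exp_ofReal_mul_I, mul_one, Real.norm_eq_abs]
    have h1 : ‖(2 : ℂ)‖ = 2 := Complex.norm_two
    have h2 : ‖Complex.exp (-((θ : ℂ) * Complex.I))‖ = 1 := by
      rw [show -((θ : ℂ) * Complex.I) = ((-θ : ℝ) : ℂ) * Complex.I by push_cast; ring,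
        Complex.norm_exp_ofReal_mul_I]
    have h3 : ‖Complex.exp (-((n : ℂ) * θ * Complex.I))‖ = 1 := by
      rw [show -((n : ℂ) * θ * Complex.I) = ((-(n * θ) : ℝ) : ℂ) * Complex.I by push_cast; ring,
        Complex.norm_exp_ofReal_mul_I]
    rw [h1, h2, h3, abs_neg, abs_div, abs_two]
    ring
  -- dominated convergence for the series
  have hsumF : HasSum (fun p => ∫ θ in (0 : ℝ)..2 * π, F p θ)
      (∫ θ in (0 : ℝ)..2 * π,
        Complex.exp ((x : ℂ) * Real.sin θ * Complex.I) * Complex.exp (-((n : ℂ) * θ * Complex.I))) := by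
    have hbs : Summable fun p : ℕ × ℕ => (|x| / 2) ^ p.1 / (p.1 ! : ℝ) * ((|x| / 2) ^ p.2 / (p.2 ! : ℝ)) :=
      (Real.summable_pow_div_factorial _).mul_of_nonneg (Real.summable_pow_div_factorial _)
        (fun _ => by positivity) (fun _ => by positivity)
    refine intervalIntegral.hasSum_integral_of_dominated_convergence
      (fun (p : ℕ × ℕ) (_ : ℝ) => (|x| / 2) ^ p.1 / (p.1 ! : ℝ) * ((|x| / 2) ^ p.2 / (p.2 ! : ℝ)))
      (fun p => (hFcont p).aestronglyMeasurable) (fun p => Eventually.of_forall fun θ _ => ?_)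
      (Eventually.of_forall fun θ _ => hbs) (by exact intervalIntegrable_const)
      (Eventually.of_forall fun θ _ => ?_)
    · rw [hFnorm]
    · simp only [hF]
      exact (hasSum_generatingFunction x θ).mul_right _
  -- each term integrates to `2π · besselJTerm` on the diagonal `j = k + n`, and to `0` elsewhere
  have hterm : ∀ p : ℕ × ℕ, ∫ θ in (0 : ℝ)..2 * π, F p θ =
      (x / 2 : ℂ) ^ p.1 / (p.1 ! : ℂ) * ((((-(x / 2) : ℝ) : ℂ)) ^ p.2 / (p.2 ! : ℂ)) *
        (if ((p.1 : ℤ) - p.2 - n) = 0 then 2 * (π : ℂ) else 0) := by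
    intro p
    rw [← integral_cexp_int_mul, ← intervalIntegral.integral_const_mul]
    refine intervalIntegral.integral_congr fun θ _ => ?_
    simp only [hF]
    have : Complex.exp ((p.1 : ℂ) * (θ * Complex.I)) * Complex.exp ((p.2 : ℂ) * -(θ * Complex.I)) *
        Complex.exp (-((n : ℂ) * θ * Complex.I)) =
        Complex.exp ((((p.1 : ℤ) - p.2 - n : ℤ) : ℂ) * θ * Complex.I) := by
      rw [← Complex.exp_add, ← Complex.exp_add]
      congr 1
      push_cast
      ring
    rw [mul_pow, mul_pow, ← Complex.exp_nat_mul, ← Complex.exp_nat_mul, ← this]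
    ring
  -- reindex the diagonal by `k ↦ (k + n, k)`
  set g : ℕ → ℕ × ℕ := fun k => (k + n, k) with hg
  have hginj : Function.Injective g := fun a b h => by
    simp only [hg, Prod.mk.injEq] at h; exact h.2
  have hoff : ∀ p ∉ Set.range g, (∫ θ in (0 : ℝ)..2 * π, F p θ) = 0 := by
    intro p hp
    rw [hterm]
    have hne : ((p.1 : ℤ) - p.2 - n) ≠ 0 := by
      intro h
      apply hp
      refine ⟨p.2, ?_⟩
      simp only [hg]
      ext
      · simp only; omega
      · rfl
    rw [if_neg hne, mul_zero]
  have hdiag : ∀ k : ℕ, (∫ θ in (0 : ℝ)..2 * π, F (g k) θ) = 2 * π * (besselJTerm n x k : ℂ) := by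
    intro k
    rw [hterm]
    simp only [hg]
    have h0 : ((k + n : ℕ) : ℤ) - (k : ℕ) - (n : ℤ) = 0 := by push_cast; ring
    rw [if_pos h0]
    have key : (x / 2) ^ (k + n) / ((k + n) ! : ℝ) * ((-(x / 2)) ^ k / (k ! : ℝ)) * (2 * π) =
        2 * π * besselJTerm n x k := by
      rw [besselJTerm, neg_pow]
      ring
    exact_mod_cast key
  have hsum2 : HasSum (fun k : ℕ => ∫ θ in (0 : ℝ)..2 * π, F (g k) θ) (2 * π * (besselJ n x : ℂ)) := by
    have h := (hasSum_besselJ_holds n x)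
    have hC : HasSum (fun k => (besselJTerm n x k : ℂ)) (besselJ n x : ℂ) :=
      (Complex.ofRealCLM.hasSum h)
    simpa only [hdiag] using hC.mul_left (2 * π : ℂ)
  have hsum3 : HasSum (fun p => ∫ θ in (0 : ℝ)..2 * π, F p θ) (2 * π * (besselJ n x : ℂ)) :=
    (hginj.hasSum_iff hoff).mp hsum2
  exact hsumF.unique hsum3

/-- **Bessel's integral over a full period**: `∫₀^{2π} cos(nθ − x sin θ) dθ = 2π J_n(x)`.
[cite: Watson1944, §2.2 (1)] -/
theorem integral_cos_sub_mul_sin_two_pi (n : ℕ) (x : ℝ) :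
    ∫ θ in (0 : ℝ)..2 * π, Real.cos (n * θ - x * Real.sin θ) = 2 * π * besselJ n x := by
  have h := integral_cexp_mul_sin_sub n x
  have hfun : (fun θ : ℝ => Complex.exp ((x : ℂ) * Real.sin θ * Complex.I) *
      Complex.exp (-((n : ℂ) * θ * Complex.I))) =
      fun θ : ℝ => (((Real.cos (n * θ - x * Real.sin θ)) : ℝ) : ℂ) +
        (((-Real.sin (n * θ - x * Real.sin θ)) : ℝ) : ℂ) * Complex.I := by
    funext θ
    rw [← Complex.exp_add, show (x : ℂ) * Real.sin θ * Complex.I + -((n : ℂ) * θ * Complex.I) =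
      ((-(n * θ - x * Real.sin θ) : ℝ) : ℂ) * Complex.I by push_cast; ring, Complex.exp_mul_I]
    push_cast
    rw [Complex.cos_neg, Complex.sin_neg]
  rw [hfun] at h
  have hc : Continuous fun θ : ℝ => Real.cos (n * θ - x * Real.sin θ) := by fun_prop
  have hs : Continuous fun θ : ℝ => -Real.sin (n * θ - x * Real.sin θ) := by fun_prop
  have hi1 : IntervalIntegrable (fun θ : ℝ => (((Real.cos (n * θ - x * Real.sin θ)) : ℝ) : ℂ))
      volume 0 (2 * π) := (Complex.continuous_ofReal.comp hc).intervalIntegrable _ _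
  have hi2 : IntervalIntegrable
      (fun θ : ℝ => (((-Real.sin (n * θ - x * Real.sin θ)) : ℝ) : ℂ) * Complex.I) volume 0 (2 * π) :=
    ((Complex.continuous_ofReal.comp hs).mul continuous_const).intervalIntegrable _ _
  rw [intervalIntegral.integral_add hi1 hi2, intervalIntegral.integral_mul_const,
    intervalIntegral.integral_ofReal, intervalIntegral.integral_ofReal] at h
  have := congrArg Complex.re h
  simpa using this

/-- **Discharge of `Literature.Analysis.FunctionSpaces.besselJ_eq_integral_cos` — Bessel's
integral**: `J_n(x) = π⁻¹ ∫₀^π cos(nθ − x sin θ) dθ` for `n ∈ ℕ`, `x ∈ ℝ`; from the full period by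
the symmetry `θ ↦ 2π − θ`. [cite: Watson1944, §2.2 (1); DLMF 10.9.2] -/
theorem besselJ_eq_integral_cos_holds : besselJ_eq_integral_cos := by
  intro n x
  set f : ℝ → ℝ := fun θ => Real.cos (n * θ - x * Real.sin θ) with hf
  have hfc : Continuous f := by simp only [hf]; fun_prop
  have hsymm : ∀ θ : ℝ, f (2 * π - θ) = f θ := by
    intro θ
    simp only [hf]
    rw [Real.sin_two_pi_sub, show (n : ℝ) * (2 * π - θ) - x * -Real.sin θ =
      -(n * θ - x * Real.sin θ) + n * (2 * π) by ring, Real.cos_add_nat_mul_two_pi, Real.cos_neg]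
  have h2 : ∫ θ in (0 : ℝ)..2 * π, f θ = 2 * ∫ θ in (0 : ℝ)..π, f θ := by
    rw [← intervalIntegral.integral_add_adjacent_intervals (hfc.intervalIntegrable 0 π)
      (hfc.intervalIntegrable π (2 * π))]
    have : ∫ θ in π..2 * π, f θ = ∫ θ in (0 : ℝ)..π, f θ := by
      have h := intervalIntegral.integral_comp_sub_left f (2 * π) (a := π) (b := 2 * π)
      simp only [hsymm, sub_self] at h
      rw [show 2 * π - π = π by ring] at h
      exact h
    rw [this]; ring
  have h1 := integral_cos_sub_mul_sin_two_pi n x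
  simp only [← hf] at h1 ⊢
  rw [h2] at h1
  have hπ : (π : ℝ) ≠ 0 := Real.pi_ne_zero
  field_simp
  linarith

/-- **Discharge of `Literature.Analysis.FunctionSpaces.abs_besselJ_le_one`**: `|J_n(x)| ≤ 1` for all
`n ∈ ℕ` and real `x` (the integrand of Bessel's integral is bounded by `1`). [cite: DLMF, 10.14.1] -/
theorem abs_besselJ_le_one_holds : abs_besselJ_le_one := by
  intro n x
  rw [besselJ_eq_integral_cos_holds n x, abs_mul, abs_inv, abs_of_pos Real.pi_pos]
  have h : ‖∫ θ in (0 : ℝ)..π, Real.cos (n * θ - x * Real.sin θ)‖ ≤ 1 * |π - 0| :=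
    intervalIntegral.norm_integral_le_of_norm_le_const fun θ _ => by
      rw [Real.norm_eq_abs]; exact Real.abs_cos_le_one _
  rw [Real.norm_eq_abs, sub_zero, abs_of_pos Real.pi_pos, one_mul] at h
  calc π⁻¹ * |∫ θ in (0 : ℝ)..π, Real.cos (n * θ - x * Real.sin θ)| ≤ π⁻¹ * π :=
        mul_le_mul_of_nonneg_left h (by positivity)
    _ = 1 := inv_mul_cancel₀ Real.pi_ne_zero

/-! ### Neumann's identity `J₀² + 2 Σ_{n ≥ 1} J_n² = 1` and the bound `|J_{n+1}| ≤ 1/√2` -/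

/-- Refined term bound keeping `n!`: `|(-1)^k/(k!(k+n)!) (x/2)^{2k+n}| ≤ (|x/2|ⁿ/n!) (|x/2|²)^k/k!`
(`(k+n)! ≥ n!`). [folklore] -/
theorem abs_besselJTerm_le' (n : ℕ) (x : ℝ) (k : ℕ) :
    |besselJTerm n x k| ≤ |x / 2| ^ n / n ! * ((|x / 2| ^ 2) ^ k / k !) := by
  have hk : (0 : ℝ) < k ! := by positivity
  have hn : (0 : ℝ) < n ! := by positivity
  have hkn : (n ! : ℝ) ≤ (k + n)! := by exact_mod_cast Nat.factorial_le (Nat.le_add_left n k)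
  rw [besselJTerm, abs_mul, abs_div, abs_pow, abs_pow, abs_neg, abs_one, one_pow,
    abs_of_pos (by positivity : (0 : ℝ) < k ! * (k + n)!)]
  calc 1 / (k ! * (k + n)! : ℝ) * |x / 2| ^ (2 * k + n)
      ≤ 1 / (k ! * n ! : ℝ) * |x / 2| ^ (2 * k + n) := by
        gcongr
    _ = |x / 2| ^ n / n ! * ((|x / 2| ^ 2) ^ k / k !) := by rw [pow_add, pow_mul]; field_simp

/-- **`|J_n(x)| ≤ (|x/2|ⁿ/n!) e^{|x/2|²}`** — the factorial decay in the order that makes series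
over `n` of Bessel functions converge (Watson §2.11 (4)). [cite: Watson1944, §2.11] -/
theorem abs_besselJ_le_pow_div_factorial (n : ℕ) (x : ℝ) :
    |besselJ n x| ≤ |x / 2| ^ n / n ! * Real.exp (|x / 2| ^ 2) := by
  have hs := hasSum_besselJ_holds n x
  have habs : Summable fun k => |besselJTerm n x k| := (summable_besselJTerm_holds n x).abs
  have hmaj : Summable fun k : ℕ => |x / 2| ^ n / n ! * ((|x / 2| ^ 2) ^ k / k !) :=
    (Real.summable_pow_div_factorial _).mul_left _
  have h1 : |besselJ n x| ≤ ∑' k, |besselJTerm n x k| := by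
    rw [← hs.tsum_eq]
    have := norm_tsum_le_tsum_norm (f := besselJTerm n x) (by simpa [Real.norm_eq_abs] using habs)
    simpa [Real.norm_eq_abs] using this
  have h2 : ∑' k, |besselJTerm n x k| ≤ ∑' k : ℕ, |x / 2| ^ n / n ! * ((|x / 2| ^ 2) ^ k / k !) :=
    habs.tsum_le_tsum (abs_besselJTerm_le' n x) hmaj
  have h3 : ∑' k : ℕ, |x / 2| ^ n / n ! * ((|x / 2| ^ 2) ^ k / k !) =
      |x / 2| ^ n / n ! * Real.exp (|x / 2| ^ 2) := by
    rw [tsum_mul_left, Real.exp_eq_exp_ℝ, NormedSpace.exp_eq_tsum_div]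
  linarith [h3 ▸ h2]

/-- **The derivative of `J_{n+1}` at every point**: `J_{n+1}' = (J_n − J_{n+2})/2` (Watson §2.12 (2);
DLMF 10.6.1), including `x = 0` (by continuity of both sides). [cite: Watson1944, §2.12 (2)] -/
theorem hasDerivAt_besselJ_succ_everywhere (n : ℕ) (x : ℝ) :
    HasDerivAt (besselJ (n + 1)) ((besselJ n x - besselJ (n + 2) x) / 2) x := by
  have hne : ∀ y : ℝ, y ≠ 0 →
      HasDerivAt (besselJ (n + 1)) ((besselJ n y - besselJ (n + 2) y) / 2) y := by
    intro y hy
    have h1 := hasDerivAt_besselJ_succ_of_ne_zero n hy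
    have h2 : HasDerivAt (besselJ (n + 1))
        ((((n : ℝ) + 1) * besselJ (n + 1) y - y * besselJ (n + 2) y) / y) y := by
      have := hasDerivAt_besselJ_of_ne_zero (n + 1) hy
      push_cast at this
      exact this
    have heq := (div_left_inj' hy).mp (h1.unique h2)
    refine h1.congr_deriv ?_
    rw [div_eq_div_iff hy two_ne_zero]
    linear_combination heq
  by_cases hx : x = 0
  · subst hx
    exact hasDerivAt_of_hasDerivAt_of_ne (fun y hy => hne y hy)
      (continuous_besselJ_holds (n + 1)).continuousAt
      (((continuous_besselJ_holds n).sub (continuous_besselJ_holds (n + 2))).div_const 2).continuousAt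
  · exact hne x hx

/-- The products `a_m(x) = J_m(x) J_{m+1}(x)` tend to `0` as `m → ∞`. [folklore] -/
theorem tendsto_besselJ_mul_besselJ_succ (x : ℝ) :
    Tendsto (fun m : ℕ => besselJ m x * besselJ (m + 1) x) atTop (𝓝 0) := by
  have hbd : ∀ m : ℕ, |besselJ m x * besselJ (m + 1) x| ≤
      |x / 2| ^ m / m ! * Real.exp (|x / 2| ^ 2) := by
    intro m
    rw [abs_mul]
    calc |besselJ m x| * |besselJ (m + 1) x| ≤ |x / 2| ^ m / m ! * Real.exp (|x / 2| ^ 2) * 1 :=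
          mul_le_mul (abs_besselJ_le_pow_div_factorial m x) (abs_besselJ_le_one_holds (m + 1) x)
            (abs_nonneg _) (by positivity)
      _ = _ := mul_one _
  have hlim : Tendsto (fun m : ℕ => |x / 2| ^ m / m ! * Real.exp (|x / 2| ^ 2)) atTop (𝓝 0) := by
    have h := (FloorSemiring.tendsto_pow_div_factorial_atTop (|x / 2|)).mul_const
      (Real.exp (|x / 2| ^ 2))
    rw [zero_mul] at h
    exact h
  exact squeeze_zero_norm (fun m => by rw [Real.norm_eq_abs]; exact hbd m) hlim

/-- **The telescoping sum** `Σ_{m ≥ 0} (J_mJ_{m+1} − J_{m+1}J_{m+2}) = J₀J₁`. [folklore] -/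
theorem hasSum_besselJ_telescope (x : ℝ) :
    HasSum (fun m : ℕ => besselJ m x * besselJ (m + 1) x - besselJ (m + 1) x * besselJ (m + 2) x)
      (besselJ 0 x * besselJ 1 x) := by
  set a : ℕ → ℝ := fun m => besselJ m x * besselJ (m + 1) x with ha
  have habs : Summable fun m : ℕ => |x / 2| ^ m / m ! * Real.exp (|x / 2| ^ 2) :=
    (Real.summable_pow_div_factorial _).mul_right _
  have hbd : ∀ m : ℕ, |a m| ≤ |x / 2| ^ m / m ! * Real.exp (|x / 2| ^ 2) := by
    intro m
    simp only [ha, abs_mul]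
    calc |besselJ m x| * |besselJ (m + 1) x| ≤ |x / 2| ^ m / m ! * Real.exp (|x / 2| ^ 2) * 1 :=
          mul_le_mul (abs_besselJ_le_pow_div_factorial m x) (abs_besselJ_le_one_holds (m + 1) x)
            (abs_nonneg _) (by positivity)
      _ = _ := mul_one _
  have hsa : Summable a :=
    Summable.of_norm_bounded habs (fun m => by rw [Real.norm_eq_abs]; exact hbd m)
  have hsum : Summable fun m => a m - a (m + 1) := hsa.sub ((summable_nat_add_iff 1).mpr hsa)
  have key : HasSum (fun m => a m - a (m + 1)) (a 0 - 0) := by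
    rw [hsum.hasSum_iff_tendsto_nat]
    have hpart : ∀ N : ℕ, ∑ m ∈ Finset.range N, (a m - a (m + 1)) = a 0 - a N := fun N =>
      Finset.sum_range_sub' a N
    simp_rw [hpart]
    exact tendsto_const_nhds.sub (tendsto_besselJ_mul_besselJ_succ x)
  simpa [ha] using key

/-- **Neumann's identity** `J₀(x)² + 2 Σ_{n ≥ 1} J_n(x)² = 1` (Watson §2.5 (3); DLMF 10.23.3 at
`ν = 0`), by differentiation: the derivative of the left side is
`−2J₀J₁ + 2Σ J_{n}(J_{n−1} − J_{n+1})`, a telescoping sum equal to `0`, and the value at `x = 0`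
is `1`. [cite: Watson1944, §2.5 (3)] -/
theorem sq_besselJ_zero_add_tsum_sq (x : ℝ) :
    besselJ 0 x ^ 2 + ∑' n : ℕ, 2 * besselJ (n + 1) x ^ 2 = 1 := by
  set g : ℕ → ℝ → ℝ := fun n y => 2 * (besselJ (n + 1) y * besselJ (n + 1) y) with hg
  set g' : ℕ → ℝ → ℝ := fun n y =>
    2 * ((besselJ n y - besselJ (n + 2) y) / 2 * besselJ (n + 1) y +
      besselJ (n + 1) y * ((besselJ n y - besselJ (n + 2) y) / 2)) with hg'
  have hgd : ∀ n y, HasDerivAt (g n) (g' n y) y := fun n y => by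
    simp only [hg, hg']
    exact ((hasDerivAt_besselJ_succ_everywhere n y).mul
      (hasDerivAt_besselJ_succ_everywhere n y)).const_mul 2
  have hg'eq : ∀ n y, g' n y =
      2 * (besselJ n y * besselJ (n + 1) y - besselJ (n + 1) y * besselJ (n + 2) y) := by
    intro n y; simp only [hg']; ring
  -- termwise differentiation on `(-R, R)`
  have hderiv : ∀ y : ℝ, HasDerivAt (fun z => ∑' n, g n z) (2 * (besselJ 0 y * besselJ 1 y)) y := by
    intro y
    set R : ℝ := |y| + 1 with hR
    have hyR : y ∈ Ioo (-R) R := by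
      constructor <;> [linarith [neg_abs_le y]; linarith [le_abs_self y]]
    have hu : Summable fun n : ℕ => 4 * ((R / 2) ^ (n + 1) / (n + 1)! * Real.exp ((R / 2) ^ 2)) := by
      have h := (Real.summable_pow_div_factorial (R / 2)).mul_right (Real.exp ((R / 2) ^ 2))
      exact ((summable_nat_add_iff 1).mpr h).mul_left 4
    have hbound : ∀ (n : ℕ) (z : ℝ), z ∈ Ioo (-R) R →
        ‖g' n z‖ ≤ 4 * ((R / 2) ^ (n + 1) / (n + 1)! * Real.exp ((R / 2) ^ 2)) := by
      intro n z hz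
      have hzR : |z / 2| ≤ R / 2 := by
        rw [abs_div, abs_two]
        have := (abs_lt.mpr hz).le
        linarith
      have hJ : |besselJ (n + 1) z| ≤ (R / 2) ^ (n + 1) / (n + 1)! * Real.exp ((R / 2) ^ 2) := by
        refine (abs_besselJ_le_pow_div_factorial (n + 1) z).trans ?_
        have h0 : 0 ≤ |z / 2| := abs_nonneg _
        gcongr
      rw [hg'eq, Real.norm_eq_abs, abs_mul, abs_two]
      have hdiff : |besselJ n z * besselJ (n + 1) z - besselJ (n + 1) z * besselJ (n + 2) z| ≤
          2 * |besselJ (n + 1) z| := by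
        calc _ ≤ |besselJ n z * besselJ (n + 1) z| + |besselJ (n + 1) z * besselJ (n + 2) z| :=
              abs_sub _ _
          _ = |besselJ n z| * |besselJ (n + 1) z| + |besselJ (n + 1) z| * |besselJ (n + 2) z| := by
              rw [abs_mul, abs_mul]
          _ ≤ 1 * |besselJ (n + 1) z| + |besselJ (n + 1) z| * 1 := by
              gcongr
              · exact abs_besselJ_le_one_holds n z
              · exact abs_besselJ_le_one_holds (n + 2) z
          _ = 2 * |besselJ (n + 1) z| := by ring
      nlinarith [hJ, hdiff, abs_nonneg (besselJ (n + 1) z)]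
    have h0 : Summable fun n => g n 0 := by
      simp only [hg, besselJ_succ_apply_zero, mul_zero]
      exact summable_zero
    have hmem0 : (0 : ℝ) ∈ Ioo (-R) R := by
      constructor
      · simp only [hR]; linarith [abs_nonneg y]
      · simp only [hR]; positivity
    have h := hasDerivAt_tsum_of_isPreconnected hu isOpen_Ioo isPreconnected_Ioo
      (fun n z _ => hgd n z) hbound hmem0 h0 hyR
    have htel : HasSum (fun n => g' n y) (2 * (besselJ 0 y * besselJ 1 y)) := by
      simp_rw [hg'eq]
      exact (hasSum_besselJ_telescope y).mul_left 2
    rwa [htel.tsum_eq] at h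
  -- the full function is constant
  set S : ℝ → ℝ := fun y => besselJ 0 y ^ 2 + ∑' n, g n y with hS
  have hSd : ∀ y, HasDerivAt S 0 y := by
    intro y
    have h0 : HasDerivAt (fun y => besselJ 0 y * besselJ 0 y)
        (-besselJ 1 y * besselJ 0 y + besselJ 0 y * -besselJ 1 y) y :=
      (hasDerivAt_besselJ_zero_holds y).mul (hasDerivAt_besselJ_zero_holds y)
    have h1 : HasDerivAt (fun y => besselJ 0 y * besselJ 0 y + ∑' n, g n y)
        (-besselJ 1 y * besselJ 0 y + besselJ 0 y * -besselJ 1 y + 2 * (besselJ 0 y * besselJ 1 y)) y :=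
      h0.add (hderiv y)
    have hfun : S = fun y => besselJ 0 y * besselJ 0 y + ∑' n, g n y := by
      funext y; simp only [hS]; ring
    rw [hfun]
    exact h1.congr_deriv (by ring)
  have hconst : S x = S 0 :=
    is_const_of_deriv_eq_zero (fun y => (hSd y).differentiableAt) (fun y => (hSd y).deriv) x 0
  have hS0 : S 0 = 1 := by
    simp only [hS, hg, besselJ_zero_zero, besselJ_succ_apply_zero, mul_zero, tsum_zero]
    norm_num
  have hgx : ∑' n, g n x = ∑' n : ℕ, 2 * besselJ (n + 1) x ^ 2 := by
    refine tsum_congr fun n => ?_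
    simp only [hg]; ring
  have := hconst
  rw [hS0] at this
  simp only [hS] at this
  rw [hgx] at this
  exact this

/-- Summability of `Σ 2 J_{n+1}(x)²`. [folklore] -/
theorem summable_sq_besselJ_succ (x : ℝ) : Summable fun n : ℕ => 2 * besselJ (n + 1) x ^ 2 := by
  have habs : Summable fun m : ℕ => 2 * (|x / 2| ^ (m + 1) / (m + 1)! * Real.exp (|x / 2| ^ 2)) := by
    have h := (Real.summable_pow_div_factorial (|x / 2|)).mul_right (Real.exp (|x / 2| ^ 2))
    exact ((summable_nat_add_iff 1).mpr h).mul_left 2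
  refine Summable.of_norm_bounded habs (fun m => ?_)
  rw [Real.norm_eq_abs, abs_mul, abs_two, abs_pow, sq_abs]
  have h1 : |besselJ (m + 1) x| ≤ 1 := abs_besselJ_le_one_holds (m + 1) x
  have h2 := abs_besselJ_le_pow_div_factorial (m + 1) x
  have h3 : besselJ (m + 1) x ^ 2 ≤ |x / 2| ^ (m + 1) / (m + 1)! * Real.exp (|x / 2| ^ 2) := by
    calc besselJ (m + 1) x ^ 2 = |besselJ (m + 1) x| * |besselJ (m + 1) x| := by
          rw [abs_mul_abs_self, sq]
      _ ≤ 1 * (|x / 2| ^ (m + 1) / (m + 1)! * Real.exp (|x / 2| ^ 2)) :=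
          mul_le_mul h1 h2 (abs_nonneg _) zero_le_one
      _ = _ := one_mul _
  linarith

/-- **Discharge of `Literature.Analysis.FunctionSpaces.abs_besselJ_succ_le`**: `|J_n(x)| ≤ 1/√2` for
`n ≥ 1` (DLMF 10.14.1), from Neumann's identity: `2 J_n² ≤ J₀² + 2Σ_{m≥1} J_m² = 1`.
[cite: DLMF, 10.14.1] -/
theorem abs_besselJ_succ_le_holds : abs_besselJ_succ_le := by
  intro n x
  have hN := sq_besselJ_zero_add_tsum_sq x
  have hle : 2 * besselJ (n + 1) x ^ 2 ≤ ∑' m : ℕ, 2 * besselJ (m + 1) x ^ 2 :=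
    (summable_sq_besselJ_succ x).le_tsum n (fun m _ => by positivity)
  have hsq : besselJ (n + 1) x ^ 2 ≤ 1 / 2 := by nlinarith [sq_nonneg (besselJ 0 x)]
  calc |besselJ (n + 1) x| ≤ Real.sqrt (1 / 2) := Real.abs_le_sqrt hsq
    _ = 1 / Real.sqrt 2 := by rw [Real.sqrt_div zero_le_one, Real.sqrt_one]

end Literature.Analysis.FunctionSpaces

end
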